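/-
COR-CM (cell pub-hodgecm2, stage 2 of the Hodge ladder) — count-neutral KERNEL COMBINATORICS «dicyclic twist, even order: the residual module read by
the strict-half functionals; the key lemma» (seat prover-pub-hodgecm2-b23-g43-0, binder prover b23, gen 43; claim DICYCLIC-EVEN, HOME/INBOX.md l.10881;
blanket `Census/DicyclicTwist*`).  Theorems only, on top of `Census/DicyclicTwistEvenMotion.lean` and parts V–VI of the odd lane
(`Census/DicyclicTwistResidual|KeyLemma.lean`, gen 42, whose bookkeeping of the normal residual labels is parity-free and used BY NAME); no `decide`
beyond closed identities in `ZMod 2`, no certificate, no named fact, no `sorry`.  `Interfaces.lean` (C1), every E term, B01, `Transposition/*`,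
`PortJoin/*` untouched.
HONEST FRAMING: `HC_CM` is NOT proved, here or anywhere in the tree; nothing here is a period, a count of record or a headline.
T5: n/a-class (no hypothesis binders beyond the model's data); checker: self, 2026-08-23.
-/
import Summits.HodgeConjecture.CorCM.Census.DicyclicTwistEvenMotion

/-!
# The dicyclic twist `Dic(ℤ/2 × A)`, `|A|` even, V: the residual module — values of `UE`, `UX`, `SE₀`, `SE₁`, parity, and THE KEY LEMMA

A vector `r` supported on the NORMAL RESIDUAL LABELS (potential `≤ 1`, `0`-coordinate of weight `≤ |A|/2`; the six shapes
`(0,0), (0,1), (0,δ t), (0,1+δ t), (δ s,0), (δ s,1)` of part VI, with coefficients `x₀, x₁, p_t, q_t, y_s, z_s`) is read by the functionals of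
`Census/DicyclicTwistEvenFunctionals.lean` as follows (`|A| ≥ 3`, any parity; §2–§3):

  `UE s r = q_s`,  `UX s r = −y_{−s}`,  `SE₁ r = x₀ − x₁ + P − Q + Y − Z`,  `SE₀ r = x₀ + x₁ + P + Q + Y + Z`

(`P = Σ p_t`, …).  If `r` is a Hodge vector, the Pohlmann forms of part VI (`form₁_eq`, `form₀_eq`) give **`SE₁ r = 2 (p_t − q_t)` and
`SE₀ r = 2 (y_t + z_t)` for every `t`** (§4: `SE₁_eq_two_mul`, `SE₀_eq_two_mul`) — so both are EVEN on residual Hodge vectors — and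
**THE KEY LEMMA** (`eq_zero_of_normal_killed`): a Hodge vector on the normal residual labels on which all `UE s`, `UX s` and `SE₀`, `SE₁` vanish is
zero.  §1 normalises a residual vector modulo pairs without any parity hypothesis (`sub_nrm₂_mem_of_residual`; gen 42's `sub_nrm₂_mem` needs
`|A|` odd only because it treats all vectors).  All [folklore].

## References
* [Pohlmann1968] H. Pohlmann, Algebraic cycles on abelian varieties of complex multiplication type, Ann. of Math. 88 (1968), Thm 1.
-/

namespace Summit.HodgeConjecture.CorCM.Census.DicyclicTwist

open Finset
open Summit.HodgeConjecture.CorCM.Census.OddSliceFacesModel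
open Summit.HodgeConjecture.CorCM.Census.OddSliceFacesSquares
open Summit.HodgeConjecture.CorCM.Census.OddSliceFacesDescent
open Summit.HodgeConjecture.CorCM.Census.EvenSliceFacesDescent

variable (A : Type) [AddCommGroup A] [Fintype A] [DecidableEq A]

/-! ## §1 Normalisation of a residual vector, any parity -/

omit [AddCommGroup A] [DecidableEq A] in
/-- For a label of class `≤ 1` (`|A| ≥ 3`): it is in the lower half iff its conjugate is not. [folklore] -/
theorem isLow_iff_not_isLow_add_one (h3 : 3 ≤ Fintype.card A) {a : Ty A} (ha : clsTy A a ≤ 1) :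
    (wt A a ≤ Fintype.card A / 2) ↔ ¬ (wt A (a + 1) ≤ Fintype.card A / 2) := by
  have hwle := wt_le A a
  rw [wt_add_one]
  unfold clsTy at ha
  constructor
  · intro h; omega
  · intro h; omega

/-- **`r − nrm₂ r ∈ P₂` for every vector `r` supported on the residual labels** (`|A| ≥ 3`, any parity). [folklore] -/
theorem sub_nrm₂_mem_of_residual (h3 : 3 ≤ Fintype.card A) {r : Ty₂ A → ℤ} (hp : ∀ Ψ, r Ψ ≠ 0 → pot A Ψ ≤ 1) :
    r - nrm₂ A r ∈ pairs₂ A := by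
  have heq : r - nrm₂ A r = ∑ Ψ ∈ univ.filter (fun Ψ : Ty₂ A => ¬ (wt A Ψ.1 ≤ Fintype.card A / 2)), r Ψ • pairVec₂ A Ψ := by
    funext χ
    rw [Pi.sub_apply, Finset.sum_apply]
    have hterm : ∀ Ψ ∈ univ.filter (fun Ψ : Ty₂ A => ¬ (wt A Ψ.1 ≤ Fintype.card A / 2)), (r Ψ • pairVec₂ A Ψ) χ =
        (if χ = Ψ then r Ψ else 0) + (if conj A χ = Ψ then r Ψ else 0) := by
      intro Ψ _
      have hc : (χ = conj A Ψ) ↔ (conj A χ = Ψ) := by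
        constructor
        · intro h; rw [h, conj_conj]
        · intro h; rw [← h, conj_conj]
      simp only [pairVec₂, Pi.smul_apply, Pi.add_apply, smul_eq_mul, Pi.single_apply, hc]
      split_ifs <;> ring
    rw [Finset.sum_congr rfl hterm, Finset.sum_add_distrib, Finset.sum_ite_eq, Finset.sum_ite_eq]
    simp only [Finset.mem_filter, Finset.mem_univ, true_and, nrm₂]
    have hpc : pot A (conj A χ) = pot A χ := pot_conj A χ
    by_cases hχ : (wt A χ.1 ≤ Fintype.card A / 2)
    · rw [if_pos hχ, if_neg (fun h => h hχ)]
      by_cases hz : r (conj A χ) = 0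
      · rw [hz]; split_ifs <;> ring
      · have hcls : clsTy A χ.1 ≤ 1 := by have := hp _ hz; rw [hpc] at this; unfold pot at this; omega
        have hnl : ¬ (wt A (conj A χ).1 ≤ Fintype.card A / 2) := (isLow_iff_not_isLow_add_one A h3 hcls).mp hχ
        rw [if_pos hnl]; ring
    · rw [if_neg hχ, if_pos hχ]
      by_cases hz : r (conj A χ) = 0
      · rw [hz]; split_ifs <;> ring
      · have hcls : clsTy A χ.1 ≤ 1 := by have := hp _ hz; rw [hpc] at this; unfold pot at this; omega
        have hl : (wt A (conj A χ).1 ≤ Fintype.card A / 2) := by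
          by_contra hc; exact hχ ((isLow_iff_not_isLow_add_one A h3 hcls).mpr hc)
        rw [if_neg (fun h => h hl)]; ring
  rw [heq]
  exact Submodule.sum_mem _ fun Ψ _ => Submodule.smul_mem _ _ (Submodule.subset_span ⟨Ψ, rfl⟩)

/-! ## §2 The weights on the normal residual labels -/

omit [AddCommGroup A] in
/-- An atom `δ t` is strictly low, its conjugate `1 + δ t` strictly high (`|A| ≥ 3`). [folklore] -/
theorem loI_delta (h3 : 3 ≤ Fintype.card A) (t : A) :
    (loI A (δ A t) = 1 ∧ upI A (δ A t) = 0) ∧ (loI A (1 + δ A t) = 0 ∧ upI A (1 + δ A t) = 1) := by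
  refine ⟨loI_upI_of_lt A (by rw [wt_delta]; omega), ?_⟩
  rw [add_comm, loI_add_one, upI_add_one]
  have h := loI_upI_of_lt A (φ := δ A t) (by rw [wt_delta]; omega)
  exact ⟨h.2, h.1⟩

omit [AddCommGroup A] in
/-- **`wE s` on the normal labels: only `(0, 1 + δ s)` carries it** (`|A| ≥ 3`). [folklore] -/
theorem wE_normal (h3 : 3 ≤ Fintype.card A) (s : A) {Ψ : Ty₂ A} (hp : pot A Ψ ≤ 1) (hl : (wt A Ψ.1 ≤ Fintype.card A / 2)) :
    wE A s Ψ = if Ψ = (0, 1 + δ A s) then 1 else 0 := by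
  obtain ⟨a, b⟩ := Ψ
  have h1 : 1 ≤ Fintype.card A := by omega
  have l0 := loI_zero A h1
  have l1 := loI_one A h1
  have lδ := fun t => (loI_delta A h3 t).1
  have l1δ := fun t => (loI_delta A h3 t).2
  have d1δ := dft_one_add_delta A s
  have hne : ∀ t, (1 : Ty A) + δ A t ≠ 0 := fun t h => not_isLow_one_add_delta A h3 t (h ▸ isLow_zero A)
  rcases normal_cases A hp hl with ⟨ha, hb⟩ | ⟨s', ha, hb⟩ <;> simp only at ha hb
  · subst ha
    rcases hb with rfl | rfl | ⟨t, rfl | rfl⟩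
    · rw [if_neg (fun h => hne s (Prod.mk.inj h).2.symm), wE_snd_zero A h1]
    · rw [if_neg (fun h => by
        have h' : (1 : Ty A) + δ A s = 1 + 0 := by rw [add_zero]; exact ((Prod.mk.inj h).2).symm
        exact delta_ne_zero A s (add_left_cancel h')), wE_snd_one A h1]
    · rw [if_neg (fun h => by
        have := congrArg (wt A) (Prod.mk.inj h).2; rw [add_comm (1 : Ty A), wt_add_one, wt_delta, wt_delta] at this; omega)]
      unfold wE; rw [(lδ t).1, (lδ t).2, l0.1, l0.2]; ring
    · by_cases hts : t = s
      · subst hts; rw [if_pos rfl]; unfold wE; rw [(l1δ t).1, (l1δ t).2, l0.1, l0.2, d1δ, if_pos rfl]; ring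
      · rw [if_neg (fun h => hts (delta_inj A (add_left_cancel (Prod.mk.inj h).2)))]
        unfold wE; rw [(l1δ t).1, (l1δ t).2, l0.1, l0.2, d1δ, if_neg hts]; ring
  · subst ha
    have hne' : ∀ e : Ty A, ((δ A s', e) : Ty₂ A) ≠ (0, 1 + δ A s) := fun e h => delta_ne_zero A s' (Prod.mk.inj h).1
    rw [if_neg (hne' b)]
    rcases hb with rfl | rfl
    · exact wE_snd_zero A h1 s _
    · exact wE_snd_one A h1 s _

omit [AddCommGroup A] in
/-- **`wX s` on the normal labels: only `(δ (−s), 0)` carries it, with value `−1`** (`|A| ≥ 3`). [folklore] -/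
theorem wX_normal [AddCommGroup A] (h3 : 3 ≤ Fintype.card A) (s : A) {Ψ : Ty₂ A} (hp : pot A Ψ ≤ 1)
    (hl : (wt A Ψ.1 ≤ Fintype.card A / 2)) : wX A s Ψ = if Ψ = (δ A (-s), 0) then -1 else 0 := by
  obtain ⟨a, b⟩ := Ψ
  have h1 : 1 ≤ Fintype.card A := by omega
  have l0 := loI_zero A h1
  have l1 := loI_one A h1
  have lδ := fun t => (loI_delta A h3 t).1
  have l1δ := fun t => (loI_delta A h3 t).2
  have d0 := dft_zero A (-s)
  have dδ := dft_delta A (-s)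
  rcases normal_cases A hp hl with ⟨ha, hb⟩ | ⟨s', ha, hb⟩ <;> simp only at ha hb
  · subst ha
    rw [if_neg (fun h => delta_ne_zero A (-s) (Prod.mk.inj h).1.symm)]
    rcases hb with rfl | rfl | ⟨t, rfl | rfl⟩
    · unfold wX; rw [l0.1, l0.2, d0]; ring
    · unfold wX; rw [l0.1, l0.2, l1.1, l1.2]; ring
    · unfold wX; rw [l0.1, l0.2, d0]; ring
    · unfold wX; rw [l0.1, l0.2, (l1δ t).1, (l1δ t).2]; ring
  · subst ha
    rcases hb with rfl | rfl
    · by_cases hs : s' = -s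
      · subst hs; rw [if_pos rfl]; unfold wX; rw [(lδ _).1, (lδ _).2, l0.1, l0.2, dδ, if_pos rfl]; ring
      · rw [if_neg (fun h => hs (delta_inj A (Prod.mk.inj h).1))]
        unfold wX; rw [(lδ _).1, (lδ _).2, l0.1, l0.2, dδ, if_neg hs]; ring
    · rw [if_neg (fun h => by have := (Prod.mk.inj h).2; exact one_ne_zero this)]
      unfold wX; rw [(lδ _).1, (lδ _).2, l1.1, l1.2]; ring

omit [AddCommGroup A] in
/-- **`wS₁` on the normal labels is the sign of the `1`-coordinate, `wS₀` the sign of the `0`-coordinate (`= 1`)** (`|A| ≥ 3`). [folklore] -/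
theorem wS_normal (h3 : 3 ≤ Fintype.card A) {Ψ : Ty₂ A} (hp : pot A Ψ ≤ 1) (hl : (wt A Ψ.1 ≤ Fintype.card A / 2)) :
    wS₀ A Ψ = 1 ∧ wS₁ A Ψ = (if Ψ.2 = 0 then 1 else 0) - (if Ψ.2 = 1 then 1 else 0) +
      (∑ t : A, if Ψ.2 = δ A t then 1 else 0) - (∑ t : A, if Ψ.2 = 1 + δ A t then 1 else 0) := by
  obtain ⟨a, b⟩ := Ψ
  haveI : Nonempty A := Fintype.card_pos_iff.mp (by omega)
  have h1 : 1 ≤ Fintype.card A := by omega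
  have h2 : 2 ≤ Fintype.card A := by omega
  have l0 := loI_zero A h1
  have l1 := loI_one A h1
  have lδ := fun t => (loI_delta A h3 t).1
  have l1δ := fun t => (loI_delta A h3 t).2
  have z1 : (0 : Ty A) ≠ 1 := zero_ne_one_ty A
  have hz : ∀ t, (0 : Ty A) ≠ δ A t := fun t h => delta_ne_zero A t h.symm
  have hz' : ∀ t, (0 : Ty A) ≠ 1 + δ A t := fun t h => one_add_delta_ne_zero A h3 t h.symm
  have ho : ∀ t, (1 : Ty A) ≠ δ A t := fun t h => delta_ne_one A h2 t h.symm
  have ho' : ∀ t, (1 : Ty A) ≠ 1 + δ A t := fun t h => one_add_delta_ne_one A t h.symm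
  have hδ1 : ∀ t, δ A t ≠ (1 : Ty A) := fun t => delta_ne_one A h2 t
  have hδ' : ∀ t t', δ A t ≠ 1 + δ A t' := fun t t' => delta_ne_one_add_delta A h3 t t'
  have h1δ0 : ∀ t, (1 : Ty A) + δ A t ≠ 0 := fun t => one_add_delta_ne_zero A h3 t
  have h1δ1 : ∀ t, (1 : Ty A) + δ A t ≠ 1 := fun t => one_add_delta_ne_one A t
  have h1δδ : ∀ t t', (1 : Ty A) + δ A t ≠ δ A t' := fun t t' h => delta_ne_one_add_delta A h3 t' t h.symm
  have sδ : ∀ t, (∑ t' : A, if δ A t = δ A t' then (1 : ℤ) else 0) = 1 := fun t => by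
    rw [Finset.sum_eq_single t, if_pos rfl]
    · intro t' _ ht'; rw [if_neg (fun h => ht' (delta_inj A h).symm)]
    · intro h; exact absurd (Finset.mem_univ t) h
  have s1δ : ∀ t, (∑ t' : A, if (1 : Ty A) + δ A t = 1 + δ A t' then (1 : ℤ) else 0) = 1 := fun t => by
    rw [Finset.sum_eq_single t, if_pos rfl]
    · intro t' _ ht'; rw [if_neg (fun h => ht' (delta_inj A (add_left_cancel h)).symm)]
    · intro h; exact absurd (Finset.mem_univ t) h
  rcases normal_cases A hp hl with ⟨ha, hb⟩ | ⟨s', ha, hb⟩ <;> simp only at ha hb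
  · subst ha
    rcases hb with rfl | rfl | ⟨t, rfl | rfl⟩
    · refine ⟨by unfold wS₀ sgI eqI; rw [l0.1, l0.2]; ring, ?_⟩
      simp only [if_true, if_neg z1, if_neg (hz _), if_neg (hz' _), Finset.sum_const_zero]
      unfold wS₁ sgI eqI; rw [l0.1, l0.2]; ring
    · refine ⟨by unfold wS₀ sgI eqI; rw [l0.1, l0.2, l1.1, l1.2]; ring, ?_⟩
      simp only [if_true, if_neg z1.symm, if_neg (ho _), if_neg (ho' _), Finset.sum_const_zero]
      unfold wS₁ sgI eqI; rw [l0.1, l0.2, l1.1, l1.2]; ring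
    · refine ⟨by unfold wS₀ sgI eqI; rw [l0.1, l0.2, (lδ t).1, (lδ t).2]; ring, ?_⟩
      simp only [if_neg (delta_ne_zero A t), if_neg (hδ1 t), if_neg (hδ' t _), Finset.sum_const_zero, sδ]
      unfold wS₁ sgI eqI; rw [l0.1, l0.2, (lδ t).1, (lδ t).2]; ring
    · refine ⟨by unfold wS₀ sgI eqI; rw [l0.1, l0.2, (l1δ t).1, (l1δ t).2]; ring, ?_⟩
      simp only [if_neg (h1δ0 t), if_neg (h1δ1 t), if_neg (h1δδ t _), Finset.sum_const_zero, s1δ]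
      unfold wS₁ sgI eqI; rw [l0.1, l0.2, (l1δ t).1, (l1δ t).2]; ring
  · subst ha
    rcases hb with rfl | rfl
    · refine ⟨by unfold wS₀ sgI eqI; rw [l0.1, l0.2, (lδ s').1, (lδ s').2]; ring, ?_⟩
      simp only [if_true, if_neg z1, if_neg (hz _), if_neg (hz' _), Finset.sum_const_zero]
      unfold wS₁ sgI eqI; rw [l0.1, l0.2, (lδ s').1, (lδ s').2]; ring
    · refine ⟨by unfold wS₀ sgI eqI; rw [l1.1, l1.2, (lδ s').1, (lδ s').2]; ring, ?_⟩
      simp only [if_true, if_neg z1.symm, if_neg (ho _), if_neg (ho' _), Finset.sum_const_zero]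
      unfold wS₁ sgI eqI; rw [l1.1, l1.2, (lδ s').1, (lδ s').2]; ring

/-! ## §3 The functionals of a normal residual vector -/

section Data

variable {A}
variable (h3 : 3 ≤ Fintype.card A) {r : Ty₂ A → ℤ} (hp : ∀ Ψ, r Ψ ≠ 0 → pot A Ψ ≤ 1) (hl : ∀ Ψ, r Ψ ≠ 0 → (wt A Ψ.1 ≤ Fintype.card A / 2))
include h3 hp hl

omit [AddCommGroup A] in
/-- **`UE s` of a normal residual vector reads `q_s = r (0, 1 + δ s)`.** [folklore] -/
theorem UE_normal (s : A) : UE A s r = r (0, 1 + δ A s) := by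
  have h := congrArg (UE A s) (eq_sum_single A r)
  rw [h, map_sum]
  simp only [map_zsmul, UE_single, mul_one, smul_eq_mul]
  rw [Finset.sum_eq_single (0, 1 + δ A s)]
  · by_cases hz : r (0, 1 + δ A s) = 0
    · rw [hz]; ring
    · rw [wE_normal A h3 s (hp _ hz) (hl _ hz), if_pos rfl]; ring
  · intro Ψ _ hne
    by_cases hz : r Ψ = 0
    · rw [hz]; ring
    · rw [wE_normal A h3 s (hp Ψ hz) (hl Ψ hz), if_neg hne]; ring
  · intro h; exact absurd (Finset.mem_univ _) h

/-- **`UX s` of a normal residual vector reads `−y_{−s} = −r (δ (−s), 0)`.** [folklore] -/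
theorem UX_normal (s : A) : UX A s r = -r (δ A (-s), 0) := by
  have h := congrArg (UX A s) (eq_sum_single A r)
  rw [h, map_sum]
  simp only [map_zsmul, UX_single, mul_one, smul_eq_mul]
  rw [Finset.sum_eq_single (δ A (-s), 0)]
  · by_cases hz : r (δ A (-s), 0) = 0
    · rw [hz]; ring
    · rw [wX_normal A h3 s (hp _ hz) (hl _ hz), if_pos rfl]; ring
  · intro Ψ _ hne
    by_cases hz : r Ψ = 0
    · rw [hz]; ring
    · rw [wX_normal A h3 s (hp Ψ hz) (hl Ψ hz), if_neg hne]; ring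
  · intro h; exact absurd (Finset.mem_univ _) h

omit [AddCommGroup A] in
/-- **`SE₀` of a normal residual vector is the total mass `x₀ + x₁ + P + Q + Y + Z`.** [folklore] -/
theorem SE₀_normal [AddCommGroup A] : SE₀ A r = r (0, 0) + r (0, 1) + ∑ t : A, r (0, δ A t) + ∑ t : A, r (0, 1 + δ A t) +
    ∑ s : A, r (δ A s, 0) + ∑ s : A, r (δ A s, 1) := by
  rw [SE₀_apply]
  show ∑ Ψ : Ty₂ A, wS₀ A Ψ * r Ψ = _
  have hw : ∀ Ψ : Ty₂ A, wS₀ A Ψ * r Ψ = r Ψ := fun Ψ => by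
    by_cases hz : r Ψ = 0
    · rw [hz]; ring
    · rw [(wS_normal A h3 (hp Ψ hz) (hl Ψ hz)).1, one_mul]
  rw [Finset.sum_congr rfl fun Ψ _ => hw Ψ, sum_eq_of_normal A h3 r fun Ψ h => ⟨hp Ψ h, hl Ψ h⟩]

omit [AddCommGroup A] in
/-- **`SE₁` of a normal residual vector is the signed mass `x₀ − x₁ + P − Q + Y − Z`.** [folklore] -/
theorem SE₁_normal [AddCommGroup A] : SE₁ A r = r (0, 0) - r (0, 1) + ∑ t : A, r (0, δ A t) - ∑ t : A, r (0, 1 + δ A t) +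
    ∑ s : A, r (δ A s, 0) - ∑ s : A, r (δ A s, 1) := by
  haveI : Nonempty A := Fintype.card_pos_iff.mp (by omega)
  have h2 : 2 ≤ Fintype.card A := by omega
  rw [SE₁_apply]
  show ∑ Ψ : Ty₂ A, wS₁ A Ψ * r Ψ = _
  have hw : ∀ Ψ : Ty₂ A, wS₁ A Ψ * r Ψ = ((if Ψ.2 = 0 then 1 else 0) - (if Ψ.2 = 1 then 1 else 0) +
      (∑ t : A, if Ψ.2 = δ A t then 1 else 0) - (∑ t : A, if Ψ.2 = 1 + δ A t then 1 else 0)) * r Ψ := fun Ψ => by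
    by_cases hz : r Ψ = 0
    · rw [hz]; ring
    · rw [(wS_normal A h3 (hp Ψ hz) (hl Ψ hz)).2]
  rw [Finset.sum_congr rfl fun Ψ _ => hw Ψ, sum_eq_of_normal A h3 _ (weighted_normal hp hl _)]
  have z1 : (0 : Ty A) ≠ 1 := zero_ne_one_ty A
  have hz : ∀ t, (0 : Ty A) ≠ δ A t := fun t h => delta_ne_zero A t h.symm
  have hz' : ∀ t, (0 : Ty A) ≠ 1 + δ A t := fun t h => one_add_delta_ne_zero A h3 t h.symm
  have ho : ∀ t, (1 : Ty A) ≠ δ A t := fun t h => delta_ne_one A h2 t h.symm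
  have ho' : ∀ t, (1 : Ty A) ≠ 1 + δ A t := fun t h => one_add_delta_ne_one A t h.symm
  have hδ1 : ∀ t, δ A t ≠ (1 : Ty A) := fun t => delta_ne_one A h2 t
  have hδ' : ∀ t t', δ A t ≠ 1 + δ A t' := fun t t' => delta_ne_one_add_delta A h3 t t'
  have h1δ0 : ∀ t, (1 : Ty A) + δ A t ≠ 0 := fun t => one_add_delta_ne_zero A h3 t
  have h1δ1 : ∀ t, (1 : Ty A) + δ A t ≠ 1 := fun t => one_add_delta_ne_one A t
  have h1δδ : ∀ t t', (1 : Ty A) + δ A t ≠ δ A t' := fun t t' h => delta_ne_one_add_delta A h3 t' t h.symm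
  have sδ : ∀ t, (∑ t' : A, if δ A t = δ A t' then (1 : ℤ) else 0) = 1 := fun t => by
    rw [Finset.sum_eq_single t, if_pos rfl]
    · intro t' _ ht'; rw [if_neg (fun h => ht' (delta_inj A h).symm)]
    · intro h; exact absurd (Finset.mem_univ t) h
  have s1δ : ∀ t, (∑ t' : A, if (1 : Ty A) + δ A t = 1 + δ A t' then (1 : ℤ) else 0) = 1 := fun t => by
    rw [Finset.sum_eq_single t, if_pos rfl]
    · intro t' _ ht'; rw [if_neg (fun h => ht' (delta_inj A (add_left_cancel h)).symm)]
    · intro h; exact absurd (Finset.mem_univ t) h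
  simp only [if_true, if_neg z1, if_neg z1.symm, if_neg (hz _), if_neg (hz' _), if_neg (ho _), if_neg (ho' _),
    if_neg (delta_ne_zero A _), if_neg (hδ1 _), if_neg (hδ' _ _), if_neg (h1δ0 _), if_neg (h1δ1 _), if_neg (h1δδ _ _),
    Finset.sum_const_zero, sδ, s1δ]
  simp only [zero_sub, sub_zero, zero_add, add_zero, one_mul, neg_mul, Finset.sum_neg_distrib]
  ring

/-! ## §4 Parity and the key lemma -/

omit [AddCommGroup A] in
/-- **`SE₁ r = 2 (p_t − q_t)` on a normal residual Hodge vector**, for every `t`. [folklore] -/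
theorem SE₁_eq_two_mul [AddCommGroup A] (hr : r ∈ hodge₂ A) (t : A) : SE₁ A r = 2 * (r (0, δ A t) - r (0, 1 + δ A t)) := by
  have hf : coef A (0, t) ⬝ᵥ marg₁ A r = 0 := ((mem_hodge₂_iff A r).mp hr).2 (0, t)
  rw [form₁_eq h3 hp hl] at hf
  rw [SE₁_normal h3 hp hl]
  linarith

omit [AddCommGroup A] in
/-- **`SE₀ r = 2 (y_t + z_t)` on a normal residual Hodge vector**, for every `t`. [folklore] -/
theorem SE₀_eq_two_mul [AddCommGroup A] (hr : r ∈ hodge₂ A) (t : A) : SE₀ A r = 2 * (r (δ A t, 0) + r (δ A t, 1)) := by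
  have hf : coef A (0, t) ⬝ᵥ marg₀ A r = 0 := ((mem_hodge₂_iff A r).mp hr).1 (0, t)
  rw [form₀_eq h3 hp hl] at hf
  rw [SE₀_normal h3 hp hl]
  linarith

omit [AddCommGroup A] in
/-- **Parity**: `SE₀`, `SE₁` are even on normal residual Hodge vectors. [folklore] -/
theorem two_dvd_SE [AddCommGroup A] (hr : r ∈ hodge₂ A) : (2 : ℤ) ∣ SE₀ A r ∧ (2 : ℤ) ∣ SE₁ A r := by
  haveI : Nonempty A := Fintype.card_pos_iff.mp (by omega)
  obtain ⟨t⟩ := (inferInstance : Nonempty A)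
  exact ⟨⟨_, SE₀_eq_two_mul h3 hp hl hr t⟩, ⟨_, SE₁_eq_two_mul h3 hp hl hr t⟩⟩

/-- **THE KEY LEMMA of the even lane.**  A Hodge vector supported on the normal residual labels on which all `UE s`, `UX s`, `SE₀`, `SE₁`
vanish is zero (`|A| ≥ 3`, any parity). [folklore] -/
theorem eq_zero_of_normal_killed (hr : r ∈ hodge₂ A) (hk : (∀ s, UE A s r = 0) ∧ (∀ s, UX A s r = 0) ∧ SE₀ A r = 0 ∧ SE₁ A r = 0) :
    r = 0 := by
  haveI : Nonempty A := Fintype.card_pos_iff.mp (by omega)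
  -- the coefficients read by `UE`, `UX`
  have hq : ∀ s, r (0, 1 + δ A s) = 0 := fun s => by rw [← UE_normal h3 hp hl s]; exact hk.1 s
  have hy : ∀ s, r (δ A s, 0) = 0 := fun s => by
    have := UX_normal h3 hp hl (-s); rw [hk.2.1 (-s), neg_neg] at this; linarith
  -- `p_t = 0`, `z_t = 0` from the parity identities
  have hpt : ∀ t, r (0, δ A t) = 0 := fun t => by
    have := SE₁_eq_two_mul h3 hp hl hr t; rw [hk.2.2.2, hq t] at this; linarith
  have hzt : ∀ t, r (δ A t, 1) = 0 := fun t => by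
    have := SE₀_eq_two_mul h3 hp hl hr t; rw [hk.2.2.1, hy t] at this; linarith
  have hP : ∑ t : A, r (0, δ A t) = 0 := Finset.sum_eq_zero fun t _ => hpt t
  have hQ : ∑ t : A, r (0, 1 + δ A t) = 0 := Finset.sum_eq_zero fun t _ => hq t
  have hY : ∑ s : A, r (δ A s, 0) = 0 := Finset.sum_eq_zero fun s _ => hy s
  have hZ : ∑ s : A, r (δ A s, 1) = 0 := Finset.sum_eq_zero fun s _ => hzt s
  -- `x₀ ± x₁ = 0`
  have h1 := SE₁_normal h3 hp hl (r := r)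
  have h0 := SE₀_normal h3 hp hl (r := r)
  rw [hk.2.2.2, hP, hQ, hY, hZ] at h1
  rw [hk.2.2.1, hP, hQ, hY, hZ] at h0
  have hx0 : r (0, 0) = 0 := by linarith
  have hx1 : r (0, 1) = 0 := by linarith
  -- every coefficient vanishes
  funext Ψ
  by_contra hne
  rcases normal_cases A (hp Ψ hne) (hl Ψ hne) with ⟨ha, hb⟩ | ⟨s, ha, hb⟩
  · obtain ⟨a, b⟩ := Ψ
    simp only at ha hb; subst ha
    rcases hb with rfl | rfl | ⟨t, rfl | rfl⟩
    · exact hne hx0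
    · exact hne hx1
    · exact hne (hpt t)
    · exact hne (hq t)
  · obtain ⟨a, b⟩ := Ψ
    simp only at ha hb; subst ha
    rcases hb with rfl | rfl
    · exact hne (hy s)
    · exact hne (hzt s)

end Data

end Summit.HodgeConjecture.CorCM.Census.DicyclicTwist
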